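import Mathlib
import Summits.Ventures.PercRepro2.RootCutTheorem
import Summits.Ventures.PercRepro2.CutFarBA3States

/-!
# The marks `b` and `a₃` behind an unmarked cut vertex, II: the class and the 24-term sorting (blind cell PercRepro2, p3 g3, 2026-08-25; `proofs/P3-BRIDGE.md` §11.9 (b))

CLASS (`CutFarBA3`): an unmarked cut vertex `c` of the support separates `VH ∋ a₁, a₂, o` from
`VL ∋ b, a₃`.  On the support every copy has the state `gluedBA` (`st_eq_gluedBA`); `K₃` is sorted by
the `b`-copy and the exact `a₃`-pattern (24 terms, `K3_eq_cutFarBA3`).  The count identity and the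
three-gadget rule follow in `CutFarBA3Count.lean` / `CutFarBA3Rule.lean`.  Own work; standard axioms.
-/

namespace Summit.Ventures.PercRepro2

open UnionCluster

namespace CovForm

namespace RootBridge

open OneTyped TypedA3 Untouched TypedFactor Separated

section Support

open Classical

variable {V : Type*} {E : Type*} [Fintype E] [DecidableEq E]
variable (ends : E → Sym2 V) (o a₁ a₂ a₃ b c : V)

/-- **`b` and `a₃` behind an unmarked cut vertex `c`**: the support graph `z ∪ F` splits into a side
`VH ∋ a₁, a₂, b` and a side `VL ∋ o, a₃` meeting only in `c`, no typed edge inside both sides, `c`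
none of the five marks. -/
structure CutFarBA3 (VL VH : Set V) (F : Finset E) (z : Config E) : Prop where
  split : ∀ e, zF F z e = true → e ∈ within ends VL ∨ e ∈ within ends VH
  cap : ∀ t, t ∈ VL → t ∈ VH → t = c
  noloop : ∀ e ∈ F, ¬ (e ∈ within ends VL ∧ e ∈ within ends VH)
  cL : c ∈ VL
  cH : c ∈ VH
  a1H : a₁ ∈ VH
  a2H : a₂ ∈ VH
  oH : o ∈ VH
  bL : b ∈ VL
  a3L : a₃ ∈ VL
  a1c : a₁ ≠ c
  a2c : a₂ ≠ c
  oc : o ≠ c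
  bc : b ≠ c
  a3c : a₃ ≠ c

omit [Fintype E] in
/-- A configuration below `z ∪ F` has its open edges within a side. -/
lemma CutFarBA3.split_of_le {VL VH : Set V} {F : Finset E} {z : Config E}
    (h : CutFarBA3 ends o a₁ a₂ a₃ b c VL VH F z) {x : Config E} (hx : x ≤ zF F z) :
    ∀ e, x e = true → e ∈ within ends VL ∨ e ∈ within ends VH := fun e he =>
  h.split e (by have := hx e; rw [he] at this; exact Bool.eq_true_of_true_le this)

/-- The five root-side bits of a configuration, read inside `VH`. -/
noncomputable def rBA (VH : Set V) (x : Config E) : R5b :=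
  (decide (Conn ends (withinRestr ends VH x) a₂ a₁), decide (Conn ends (withinRestr ends VH x) a₁ c),
    decide (Conn ends (withinRestr ends VH x) a₂ c), decide (Conn ends (withinRestr ends VH x) a₁ o),
    decide (Conn ends (withinRestr ends VH x) a₂ o))

/-- A far bit `c ↔ v` of a configuration, read inside `VL`. -/
noncomputable def gBA (VL : Set V) (v : V) (x : Config E) : Bool :=
  decide (Conn ends (withinRestr ends VL x) c v)

omit [Fintype E] [DecidableEq E] in
/-- A transitivity implication as a Boolean clause. -/
lemma imp_clause'' (A B C : Prop) [Decidable A] [Decidable B] [Decidable C] (h : A → B → C) :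
    (!(decide A && decide B) || decide C) = true := by
  by_cases hA : A <;> by_cases hB : B <;> simp [hA, hB]
  exact h hA hB

omit [Fintype E] [DecidableEq E] in
/-- **The root-side bits are valid**: transitivity of the connection relation. -/
lemma rBA_valid (VH : Set V) (x : Config E) : Valid5b (rBA ends o a₁ a₂ c VH x) = true := by
  unfold Valid5b rBA R5b.q R5b.a1 R5b.a2 R5b.lo R5b.ho
  simp only [Bool.and_eq_true]
  refine ⟨⟨⟨⟨⟨?_, ?_⟩, ?_⟩, ?_⟩, ?_⟩, ?_⟩
  · exact imp_clause'' _ _ _ fun h1 h2 => conn_trans h2 (conn_symm h1)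
  · exact imp_clause'' _ _ _ fun h1 h2 => conn_trans h2 h1
  · exact imp_clause'' _ _ _ fun h1 h2 => conn_trans (conn_symm h2) h1
  · exact imp_clause'' _ _ _ fun h1 h2 => conn_trans h2 (conn_symm h1)
  · exact imp_clause'' _ _ _ fun h1 h2 => conn_trans h2 h1
  · exact imp_clause'' _ _ _ fun h1 h2 => conn_trans (conn_symm h2) h1

omit [Fintype E] in
/-- **The state of a copy of the support**. -/
theorem st_eq_gluedBA {VL VH : Set V} {F : Finset E} {z : Config E}
    (h : CutFarBA3 ends o a₁ a₂ a₃ b c VL VH F z) {x : Config E} (hx : ∀ e, e ∉ F → x e = z e) :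
    st ends o a₁ a₂ a₃ b x =
      gluedBA (rBA ends o a₁ a₂ c VH x) (gBA ends c VL b x) (gBA ends c VL a₃ x) := by
  have hsp := CutFarBA3.split_of_le ends o a₁ a₂ a₃ b c h (le_zF hx)
  have hsp' : ∀ e, x e = true → e ∈ within ends VH ∨ e ∈ within ends VL := fun e he =>
    (hsp e he).symm
  have hcap' : ∀ t, t ∈ VH → t ∈ VL → t = c := fun t h1 h2 => h.cap t h2 h1
  unfold st gluedBA rBA gBA R5b.q R5b.a1 R5b.a2 R5b.lo R5b.ho
  have e1 := conn_side ends hsp' hcap' h.a2H h.a1H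
  have e2 := conn_side ends hsp' hcap' h.a1H h.oH
  have e3 := conn_side ends hsp' hcap' h.a2H h.oH
  have e4 := conn_cross ends hsp' hcap' ⟨h.cH, h.cL⟩ h.a1H h.bL h.bc
  have e5 := conn_cross ends hsp' hcap' ⟨h.cH, h.cL⟩ h.a2H h.bL h.bc
  have e6 := conn_cross ends hsp' hcap' ⟨h.cH, h.cL⟩ h.a1H h.a3L h.a3c
  have e7 := conn_cross ends hsp' hcap' ⟨h.cH, h.cL⟩ h.a2H h.a3L h.a3c
  rw [decide_eq_decide.mpr e1, decide_eq_decide.mpr e2, decide_eq_decide.mpr e3,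
    decide_eq_decide.mpr e4, decide_eq_decide.mpr e5, decide_eq_decide.mpr e6,
    decide_eq_decide.mpr e7]
  · simp only [Bool.decide_and]
  all_goals infer_instance

end Support

section Main

open Classical

variable {V : Type*} {E : Type*} [Fintype E] [DecidableEq E] {R : Type*} [Field R]
  [LinearOrder R] [IsStrictOrderedRing R]
variable (ends : E → Sym2 V) (o a₁ a₂ a₃ b c : V)

/-- A root-side pattern kernel, read on the root side. -/
noncomputable def hKBA (VH : Set V) (ox oy ow sx sy sw : Bool) :
    Config E → Config E → Config E → R :=
  fun x y w => ((patBA ox oy ow sx sy sw (rBA ends o a₁ a₂ c VH x) (rBA ends o a₁ a₂ c VH y)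
    (rBA ends o a₁ a₂ c VH w) : ℤ) : R)

/-- A `b`-selector: `indBA g` when the copy is the `o`-copy, else `1`. -/
def ofxBA (sel g : Bool) : ℤ := if sel then indBA g else 1

/-- The selector on the selected copy. -/
@[simp] lemma ofxBA_true (g : Bool) : ofxBA true g = indBA g := rfl
/-- The selector on an unselected copy. -/
@[simp] lemma ofxBA_false (g : Bool) : ofxBA false g = 1 := rfl

/-- A far-side pattern kernel: the `b`-bit of the selected copy times the exact `a₃`-pattern. -/
noncomputable def lKBA3 (VL : Set V) (ox oy ow sx sy sw : Bool) :
    Config E → Config E → Config E → R :=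
  fun x y w => ((ofxBA ox (gBA ends c VL b x) * ofxBA oy (gBA ends c VL b y) * ofxBA ow (gBA ends c VL b w) *
    exactBA sx sy sw (gBA ends c VL a₃ x) (gBA ends c VL a₃ y) (gBA ends c VL a₃ w) : ℤ) : R)

omit [Fintype E] [LinearOrder R] [IsStrictOrderedRing R] in
/-- The root-side bits only see the root-side typed edges. -/
lemma rBA_restr (VH : Set V) {F : Finset E} {z x : Config E} (hx : ∀ e, e ∉ F → x e = z e) :
    rBA ends o a₁ a₂ c VH (restr (sideF ends VH F) z x) = rBA ends o a₁ a₂ c VH x := by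
  unfold rBA
  rw [withinRestr_restr_eq ends VH hx]

omit [Fintype E] [LinearOrder R] [IsStrictOrderedRing R] in
/-- The far-side bits only see the far-side typed edges. -/
lemma gBA_restr (VL : Set V) (v : V) {F : Finset E} {z x : Config E}
    (hx : ∀ e, e ∉ F → x e = z e) :
    gBA ends c VL v (restr (sideF ends VL F) z x) = gBA ends c VL v x := by
  unfold gBA
  rw [withinRestr_restr_eq ends VL hx]

omit [Fintype E] [LinearOrder R] [IsStrictOrderedRing R] in
/-- **`K₃` on the support**: the 24-term form (`b`-copy × exact `a₃`-pattern). -/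
theorem K3_eq_cutFarBA3 {VL VH : Set V} {F : Finset E} {z : Config E}
    (h : CutFarBA3 ends o a₁ a₂ a₃ b c VL VH F z) {x y w : Config E}
    (hx : ∀ e, e ∉ F → x e = z e) (hy : ∀ e, e ∉ F → y e = z e) (hw : ∀ e, e ∉ F → w e = z e) :
    (K3 ends o a₁ a₂ a₃ b x y w : R) =
      lKBA3 ends a₃ b c VL true false false false false false (restr (sideF ends VL F) z x)
          (restr (sideF ends VL F) z y) (restr (sideF ends VL F) z w) *
        hKBA ends o a₁ a₂ c VH true false false false false false (restr (sideF ends VH F) z x)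
          (restr (sideF ends VH F) z y) (restr (sideF ends VH F) z w) +
      lKBA3 ends a₃ b c VL true false false true false false (restr (sideF ends VL F) z x)
          (restr (sideF ends VL F) z y) (restr (sideF ends VL F) z w) *
        hKBA ends o a₁ a₂ c VH true false false true false false (restr (sideF ends VH F) z x)
          (restr (sideF ends VH F) z y) (restr (sideF ends VH F) z w) +
      lKBA3 ends a₃ b c VL true false false false true false (restr (sideF ends VL F) z x)
          (restr (sideF ends VL F) z y) (restr (sideF ends VL F) z w) *
        hKBA ends o a₁ a₂ c VH true false false false true false (restr (sideF ends VH F) z x)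
          (restr (sideF ends VH F) z y) (restr (sideF ends VH F) z w) +
      lKBA3 ends a₃ b c VL true false false false false true (restr (sideF ends VL F) z x)
          (restr (sideF ends VL F) z y) (restr (sideF ends VL F) z w) *
        hKBA ends o a₁ a₂ c VH true false false false false true (restr (sideF ends VH F) z x)
          (restr (sideF ends VH F) z y) (restr (sideF ends VH F) z w) +
      lKBA3 ends a₃ b c VL true false false true true false (restr (sideF ends VL F) z x)
          (restr (sideF ends VL F) z y) (restr (sideF ends VL F) z w) *
        hKBA ends o a₁ a₂ c VH true false false true true false (restr (sideF ends VH F) z x)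
          (restr (sideF ends VH F) z y) (restr (sideF ends VH F) z w) +
      lKBA3 ends a₃ b c VL true false false true false true (restr (sideF ends VL F) z x)
          (restr (sideF ends VL F) z y) (restr (sideF ends VL F) z w) *
        hKBA ends o a₁ a₂ c VH true false false true false true (restr (sideF ends VH F) z x)
          (restr (sideF ends VH F) z y) (restr (sideF ends VH F) z w) +
      lKBA3 ends a₃ b c VL true false false false true true (restr (sideF ends VL F) z x)
          (restr (sideF ends VL F) z y) (restr (sideF ends VL F) z w) *
        hKBA ends o a₁ a₂ c VH true false false false true true (restr (sideF ends VH F) z x)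
          (restr (sideF ends VH F) z y) (restr (sideF ends VH F) z w) +
      lKBA3 ends a₃ b c VL true false false true true true (restr (sideF ends VL F) z x)
          (restr (sideF ends VL F) z y) (restr (sideF ends VL F) z w) *
        hKBA ends o a₁ a₂ c VH true false false true true true (restr (sideF ends VH F) z x)
          (restr (sideF ends VH F) z y) (restr (sideF ends VH F) z w) +
      lKBA3 ends a₃ b c VL false true false false false false (restr (sideF ends VL F) z x)
          (restr (sideF ends VL F) z y) (restr (sideF ends VL F) z w) *
        hKBA ends o a₁ a₂ c VH false true false false false false (restr (sideF ends VH F) z x)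
          (restr (sideF ends VH F) z y) (restr (sideF ends VH F) z w) +
      lKBA3 ends a₃ b c VL false true false true false false (restr (sideF ends VL F) z x)
          (restr (sideF ends VL F) z y) (restr (sideF ends VL F) z w) *
        hKBA ends o a₁ a₂ c VH false true false true false false (restr (sideF ends VH F) z x)
          (restr (sideF ends VH F) z y) (restr (sideF ends VH F) z w) +
      lKBA3 ends a₃ b c VL false true false false true false (restr (sideF ends VL F) z x)
          (restr (sideF ends VL F) z y) (restr (sideF ends VL F) z w) *
        hKBA ends o a₁ a₂ c VH false true false false true false (restr (sideF ends VH F) z x)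
          (restr (sideF ends VH F) z y) (restr (sideF ends VH F) z w) +
      lKBA3 ends a₃ b c VL false true false false false true (restr (sideF ends VL F) z x)
          (restr (sideF ends VL F) z y) (restr (sideF ends VL F) z w) *
        hKBA ends o a₁ a₂ c VH false true false false false true (restr (sideF ends VH F) z x)
          (restr (sideF ends VH F) z y) (restr (sideF ends VH F) z w) +
      lKBA3 ends a₃ b c VL false true false true true false (restr (sideF ends VL F) z x)
          (restr (sideF ends VL F) z y) (restr (sideF ends VL F) z w) *
        hKBA ends o a₁ a₂ c VH false true false true true false (restr (sideF ends VH F) z x)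
          (restr (sideF ends VH F) z y) (restr (sideF ends VH F) z w) +
      lKBA3 ends a₃ b c VL false true false true false true (restr (sideF ends VL F) z x)
          (restr (sideF ends VL F) z y) (restr (sideF ends VL F) z w) *
        hKBA ends o a₁ a₂ c VH false true false true false true (restr (sideF ends VH F) z x)
          (restr (sideF ends VH F) z y) (restr (sideF ends VH F) z w) +
      lKBA3 ends a₃ b c VL false true false false true true (restr (sideF ends VL F) z x)
          (restr (sideF ends VL F) z y) (restr (sideF ends VL F) z w) *
        hKBA ends o a₁ a₂ c VH false true false false true true (restr (sideF ends VH F) z x)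
          (restr (sideF ends VH F) z y) (restr (sideF ends VH F) z w) +
      lKBA3 ends a₃ b c VL false true false true true true (restr (sideF ends VL F) z x)
          (restr (sideF ends VL F) z y) (restr (sideF ends VL F) z w) *
        hKBA ends o a₁ a₂ c VH false true false true true true (restr (sideF ends VH F) z x)
          (restr (sideF ends VH F) z y) (restr (sideF ends VH F) z w) +
      lKBA3 ends a₃ b c VL false false true false false false (restr (sideF ends VL F) z x)
          (restr (sideF ends VL F) z y) (restr (sideF ends VL F) z w) *
        hKBA ends o a₁ a₂ c VH false false true false false false (restr (sideF ends VH F) z x)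
          (restr (sideF ends VH F) z y) (restr (sideF ends VH F) z w) +
      lKBA3 ends a₃ b c VL false false true true false false (restr (sideF ends VL F) z x)
          (restr (sideF ends VL F) z y) (restr (sideF ends VL F) z w) *
        hKBA ends o a₁ a₂ c VH false false true true false false (restr (sideF ends VH F) z x)
          (restr (sideF ends VH F) z y) (restr (sideF ends VH F) z w) +
      lKBA3 ends a₃ b c VL false false true false true false (restr (sideF ends VL F) z x)
          (restr (sideF ends VL F) z y) (restr (sideF ends VL F) z w) *
        hKBA ends o a₁ a₂ c VH false false true false true false (restr (sideF ends VH F) z x)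
          (restr (sideF ends VH F) z y) (restr (sideF ends VH F) z w) +
      lKBA3 ends a₃ b c VL false false true false false true (restr (sideF ends VL F) z x)
          (restr (sideF ends VL F) z y) (restr (sideF ends VL F) z w) *
        hKBA ends o a₁ a₂ c VH false false true false false true (restr (sideF ends VH F) z x)
          (restr (sideF ends VH F) z y) (restr (sideF ends VH F) z w) +
      lKBA3 ends a₃ b c VL false false true true true false (restr (sideF ends VL F) z x)
          (restr (sideF ends VL F) z y) (restr (sideF ends VL F) z w) *
        hKBA ends o a₁ a₂ c VH false false true true true false (restr (sideF ends VH F) z x)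
          (restr (sideF ends VH F) z y) (restr (sideF ends VH F) z w) +
      lKBA3 ends a₃ b c VL false false true true false true (restr (sideF ends VL F) z x)
          (restr (sideF ends VL F) z y) (restr (sideF ends VL F) z w) *
        hKBA ends o a₁ a₂ c VH false false true true false true (restr (sideF ends VH F) z x)
          (restr (sideF ends VH F) z y) (restr (sideF ends VH F) z w) +
      lKBA3 ends a₃ b c VL false false true false true true (restr (sideF ends VL F) z x)
          (restr (sideF ends VL F) z y) (restr (sideF ends VL F) z w) *
        hKBA ends o a₁ a₂ c VH false false true false true true (restr (sideF ends VH F) z x)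
          (restr (sideF ends VH F) z y) (restr (sideF ends VH F) z w) +
      lKBA3 ends a₃ b c VL false false true true true true (restr (sideF ends VL F) z x)
          (restr (sideF ends VL F) z y) (restr (sideF ends VL F) z w) *
        hKBA ends o a₁ a₂ c VH false false true true true true (restr (sideF ends VH F) z x)
          (restr (sideF ends VH F) z y) (restr (sideF ends VH F) z w) := by
  rw [K3_eq_KB, st_eq_gluedBA ends o a₁ a₂ a₃ b c h hx, st_eq_gluedBA ends o a₁ a₂ a₃ b c h hy,
    st_eq_gluedBA ends o a₁ a₂ a₃ b c h hw]
  have hpat : KB (gluedBA (rBA ends o a₁ a₂ c VH x) (gBA ends c VL b x) (gBA ends c VL a₃ x))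
      (gluedBA (rBA ends o a₁ a₂ c VH y) (gBA ends c VL b y) (gBA ends c VL a₃ y))
      (gluedBA (rBA ends o a₁ a₂ c VH w) (gBA ends c VL b w) (gBA ends c VL a₃ w)) =
      patBA (gBA ends c VL b x) (gBA ends c VL b y) (gBA ends c VL b w)
        (gBA ends c VL a₃ x) (gBA ends c VL a₃ y) (gBA ends c VL a₃ w)
        (rBA ends o a₁ a₂ c VH x) (rBA ends o a₁ a₂ c VH y) (rBA ends o a₁ a₂ c VH w) := rfl
  rw [hpat, KB_gluedBA_lin (gBA ends c VL b x) (gBA ends c VL b y) (gBA ends c VL b w)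
    (gBA ends c VL a₃ x) (gBA ends c VL a₃ y) (gBA ends c VL a₃ w)
    (rBA ends o a₁ a₂ c VH x) (rBA ends o a₁ a₂ c VH y) (rBA ends o a₁ a₂ c VH w)]
  rw [    KB_gluedBA_pat true false false (gBA ends c VL a₃ x) (gBA ends c VL a₃ y) (gBA ends c VL a₃ w)
      (rBA ends o a₁ a₂ c VH x) (rBA ends o a₁ a₂ c VH y) (rBA ends o a₁ a₂ c VH w),
    KB_gluedBA_pat false true false (gBA ends c VL a₃ x) (gBA ends c VL a₃ y) (gBA ends c VL a₃ w)
      (rBA ends o a₁ a₂ c VH x) (rBA ends o a₁ a₂ c VH y) (rBA ends o a₁ a₂ c VH w),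
    KB_gluedBA_pat false false true (gBA ends c VL a₃ x) (gBA ends c VL a₃ y) (gBA ends c VL a₃ w)
      (rBA ends o a₁ a₂ c VH x) (rBA ends o a₁ a₂ c VH y) (rBA ends o a₁ a₂ c VH w)]
  unfold hKBA lKBA3
  simp only [rBA_restr ends o a₁ a₂ c VH hx, rBA_restr ends o a₁ a₂ c VH hy,
    rBA_restr ends o a₁ a₂ c VH hw, gBA_restr ends c VL b hx, gBA_restr ends c VL b hy,
    gBA_restr ends c VL b hw, gBA_restr ends c VL a₃ hx, gBA_restr ends c VL a₃ hy,
    gBA_restr ends c VL a₃ hw, ofxBA_true, ofxBA_false]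
  push_cast
  ring

end Main

end RootBridge

end CovForm

end Summit.Ventures.PercRepro2
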